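import Summits.Ventures.LatticeQCDFlow.Scaling.SectorExactAveragedStaleSet
import Summits.Ventures.LatticeQCDFlow.Scaling.BooleanStarHubDominationLaw

/-!
HONEST FRAMING: exact (Metropolis-corrected) sampling algorithms for lattice gauge theory; figures
of merit are autocorrelation/cost numbers at stated couplings and volumes; no continuum-physics
claim.

# SectorExactTwoStepStaleSet — THE STALE POTENTIAL OF THE PARTITION-EXACT AUGMENTATION CONTRACTS OVER TWO STEPS UNDER ONE-SIDED
# DOMINATION ALONE: `P̂²Ψ ≤ (1−δ)Ψ`, `P̂Ψ ≤ Ψ`, HENCE `P{D_n ≠ ∅} ≤ ((θ+K)/θ)·(1 − δ)^{⌊n/2⌋}`,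
# `δ = min{(1−t)w_0(1−θ)·p·ct/m, ((1−t)w_0θ − (1−θ)t)/(K+θ)}` — NO ACCEPTANCE FLOOR (lean-2 GEN-30, ours)

Venture-side (OURS).  Cell `lqcd-flow` (pub-lqcd), unit `pub-lqcd-lean-2-g30`, 2026-08-28.  Chapter Q (item 1 for sector-exact maps on a
general `S`), file 12b.  Assembles `Scaling/SectorExactAveragedStaleSet` (drift with the exact entry gain; the redraw branch carries
`≥ (1−t)w_0(1−θ)(t/m)·p` per listed stale level) with the generic two-step decay lemma of `Scaling/BooleanStarHubDominationLaw`.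

## What is proved

* `sectorAug_step_stalePotential_le_one` (`P̂Ψ ≤ Ψ` under `(1−θ)t ≤ (1−t)w_0θ`); **`sectorAug_twoStep_stalePotential_le`** —
  `Σ_b P̂(a,b)·Σ_{b'} P̂(b,b')Ψ(b'.2) ≤ (1 − δ)·Ψ(a.2)` (hub stale: the first step gains `(1−t)w_0θ − (1−θ)t ≥ δ(θ+K)`; hub fresh: the second
  step's averaged gain is `≥ (1−t)w_0(1−θ)(t/m)·p·c` per stale cold level); **`sectorAug_stale_le_dom`** — from `δ_{(x,univ)}`,
  **`Σ_{(z,D): D ≠ ∅} λ̂_n(z,D) ≤ ((θ+K)/θ)·(1 − δ)^{⌊n/2⌋}`** (`m ≥ 1`, `0 ≤ t ≤ 1`, `w` a probability vector, `μ > 0` summing to one,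
  exact hot redraws, row-stochastic cold kernels, hub multiplicities `≥ c`, `0 < θ ≤ 1`, `(1−θ)t ≤ (1−t)w_0θ`, `p ≥ 0`).

NOT CLAIMED here: the law (file 13).  Literature grade (cell rule): OWN; nothing cited as a fact; no new bib keys.
-/

noncomputable section

open Finset Function
open Literature.Probability.MarkovChains

namespace Summit.Ventures.LatticeQCDFlow.Scaling

variable {S : Type*} [Fintype S] [DecidableEq S] {K m : ℕ} {μ : Fin (K + 1) → S → ℝ} {M : Fin (K + 1) → S → S → ℝ}
  {w : Fin (K + 1) → ℝ} {t : ℝ}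

section TwoStepStale
variable (κ : Fin m → Fin K) (φ : Fin m → Equiv.Perm S)

/-- **THE ONE-STEP SUPERMARTINGALE (no floor):** `Σ_b P̂(a,b)Ψ(b.2) ≤ Ψ(a.2)` under `(1−θ)t ≤ (1−t)w_0θ`. [ours] -/
theorem sectorAug_step_stalePotential_le_one (hm : 1 ≤ m) (ht0 : 0 ≤ t) (hw1 : ∑ k, w k = 1)
    (hM : ∀ k, IsRowStochastic (M k)) (hμ : ∀ k x, 0 < μ k x)
    {α : Fin m → (Fin (K + 1) → S) → ℝ}
    (hα : ∀ r z, α r z = min 1 (tensorFun μ (edgeFlowSwap (φ r) 0 (κ r).succ z) / tensorFun μ z))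
    {θ : ℝ} (hθ1 : θ ≤ 1) (hreg : (1 - θ) * t ≤ (1 - t) * w 0 * θ)
    {Ψ : Finset (Fin (K + 1)) → ℝ}
    (hΨ : ∀ D, Ψ D = ∑ k : Fin (K + 1), (if k = 0 then θ else 1) * (if k ∈ D then (1 : ℝ) else 0))
    {Ph : (Fin (K + 1) → S) × Finset (Fin (K + 1)) → (Fin (K + 1) → S) × Finset (Fin (K + 1)) → ℝ}
    (hPh : ∀ a b, Ph a b = ∑ r : Fin m, t / m *
        ((fun r a => α r a.1) r a * (if b.1 = edgeFlowSwap (φ r) 0 (κ r).succ a.1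
            ∧ b.2 = a.2.image (Equiv.swap (0 : Fin (K + 1)) (κ r).succ) then (1 : ℝ) else 0)
          + (α r a.1 - (fun r a => α r a.1) r a) * (if b.1 = edgeFlowSwap (φ r) 0 (κ r).succ a.1
            ∧ b.2 = (fun (_ : Fin m) (D : Finset (Fin (K + 1))) => D) r a.2 then (1 : ℝ) else 0)
          + (1 - α r a.1) * (if b.1 = a.1 ∧ b.2 = (fun (_ : Fin m) (D : Finset (Fin (K + 1))) => D) r a.2 then (1 : ℝ) else 0))
      + (1 - t) * ∑ k : Fin (K + 1), w k * (coordKernel M k a.1 b.1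
          * (if b.2 = (if k = 0 then a.2.erase 0 else a.2) then (1 : ℝ) else 0)))
    (a : (Fin (K + 1) → S) × Finset (Fin (K + 1))) : ∑ b, Ph a b * Ψ b.2 ≤ Ψ a.2 := by
  set G : (Fin (K + 1) → S) × Finset (Fin (K + 1)) → ℝ := fun a => if (0 : Fin (K + 1)) ∈ a.2
      then (1 - t) * w 0 * θ - (1 - θ) * t
      else (1 - θ) * (t / m) * ∑ r : Fin m, α r a.1 * (if (κ r).succ ∈ a.2 then (1 : ℝ) else 0) with hG
  have h := sectorAug_step_stalePotential_le_gain κ φ hm ht0 hw1 hM hμ hα hθ1 hΨ (G := G) (fun _ => rfl) hPh a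
  linarith [sectorAug_gain_nonneg κ φ hμ ht0 hθ1 hreg hα (G := G) (fun _ => rfl) a]

/-- **THE TWO-STEP CONTRACTION OF THE STALE POTENTIAL UNDER ONE-SIDED DOMINATION:** for every augmented state `a`,
**`Σ_b P̂(a,b)·Σ_{b'} P̂(b,b')Ψ(b'.2) ≤ (1 − δ)·Ψ(a.2)`, `δ = min{(1−t)w_0·(1−θ)·p·c·t/m, ((1−t)w_0·θ − (1−θ)t)/(K+θ)}`** (`m ≥ 1`,
`0 ≤ t ≤ 1`, `w` a probability vector, `μ > 0` summing to one, exact hot redraws, row-stochastic cold kernels, hub multiplicities `≥ c`,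
`0 < θ ≤ 1`, `(1−θ)t ≤ (1−t)w_0θ`, `p ≥ 0` with `p·μ_{κ_r+1}(φ_r u) ≤ μ_0(u)`) — no acceptance floor. [ours] -/
theorem sectorAug_twoStep_stalePotential_le (hm : 1 ≤ m) (ht0 : 0 ≤ t) (ht1 : t ≤ 1) (hw0 : ∀ k, 0 ≤ w k) (hw1 : ∑ k, w k = 1)
    (hM : ∀ k, IsRowStochastic (M k)) (hM0 : ∀ u v, M 0 u v = μ 0 v) (hμ : ∀ k x, 0 < μ k x) (hμ1 : ∀ k, ∑ u, μ k u = 1)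
    {α : Fin m → (Fin (K + 1) → S) → ℝ}
    (hα : ∀ r z, α r z = min 1 (tensorFun μ (edgeFlowSwap (φ r) 0 (κ r).succ z) / tensorFun μ z))
    {p : ℝ} (hp0 : 0 ≤ p) (hdom : ∀ r u, p * μ (κ r).succ (φ r u) ≤ μ 0 u)
    {θ : ℝ} (hθ0 : 0 < θ) (hθ1 : θ ≤ 1) (hreg : (1 - θ) * t ≤ (1 - t) * w 0 * θ)
    {c : ℕ} (hc : ∀ p' : Fin K, c ≤ (univ.filter (fun r : Fin m => κ r = p')).card)
    {Ψ : Finset (Fin (K + 1)) → ℝ}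
    (hΨ : ∀ D, Ψ D = ∑ k : Fin (K + 1), (if k = 0 then θ else 1) * (if k ∈ D then (1 : ℝ) else 0))
    {Ph : (Fin (K + 1) → S) × Finset (Fin (K + 1)) → (Fin (K + 1) → S) × Finset (Fin (K + 1)) → ℝ}
    (hPh : ∀ a b, Ph a b = ∑ r : Fin m, t / m *
        ((fun r a => α r a.1) r a * (if b.1 = edgeFlowSwap (φ r) 0 (κ r).succ a.1
            ∧ b.2 = a.2.image (Equiv.swap (0 : Fin (K + 1)) (κ r).succ) then (1 : ℝ) else 0)
          + (α r a.1 - (fun r a => α r a.1) r a) * (if b.1 = edgeFlowSwap (φ r) 0 (κ r).succ a.1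
            ∧ b.2 = (fun (_ : Fin m) (D : Finset (Fin (K + 1))) => D) r a.2 then (1 : ℝ) else 0)
          + (1 - α r a.1) * (if b.1 = a.1 ∧ b.2 = (fun (_ : Fin m) (D : Finset (Fin (K + 1))) => D) r a.2 then (1 : ℝ) else 0))
      + (1 - t) * ∑ k : Fin (K + 1), w k * (coordKernel M k a.1 b.1
          * (if b.2 = (if k = 0 then a.2.erase 0 else a.2) then (1 : ℝ) else 0)))
    (a : (Fin (K + 1) → S) × Finset (Fin (K + 1))) :
    ∑ b, Ph a b * ∑ b', Ph b b' * Ψ b'.2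
      ≤ (1 - min ((1 - t) * w 0 * (1 - θ) * p * c * t / m) (((1 - t) * w 0 * θ - (1 - θ) * t) / (K + θ))) * Ψ a.2 := by
  obtain ⟨z, D⟩ := a
  have hmpos : (0 : ℝ) < m := Nat.cast_pos.mpr (by omega)
  set G : (Fin (K + 1) → S) × Finset (Fin (K + 1)) → ℝ := fun a => if (0 : Fin (K + 1)) ∈ a.2
      then (1 - t) * w 0 * θ - (1 - θ) * t
      else (1 - θ) * (t / m) * ∑ r : Fin m, α r a.1 * (if (κ r).succ ∈ a.2 then (1 : ℝ) else 0) with hG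
  have hgain := sectorAug_step_stalePotential_le_gain κ φ hm ht0 hw1 hM hμ hα hθ1 hΨ (G := G) (fun _ => rfl) hPh
  have hG0 := sectorAug_gain_nonneg κ φ hμ ht0 hθ1 hreg hα (G := G) (fun _ => rfl)
  have hPs := sectorAug_isRowStochastic κ φ hm ht0 ht1 hw0 hw1 hM hμ hα hPh
  obtain ⟨hΨ0, hΨK⟩ := stalePotential_le hθ0.le hΨ D
  set δ := min ((1 - t) * w 0 * (1 - θ) * p * c * t / m) (((1 - t) * w 0 * θ - (1 - θ) * t) / (K + θ)) with hδ
  have hδ0 : 0 ≤ δ := le_min (by have := sub_nonneg.mpr hθ1; have := sub_nonneg.mpr ht1; have := hw0 0; positivity)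
    (div_nonneg (by linarith) (by positivity))
  have hstep2 : ∑ b, Ph (z, D) b * ∑ b', Ph b b' * Ψ b'.2 ≤ ∑ b, Ph (z, D) b * Ψ b.2 - ∑ b, Ph (z, D) b * G b := by
    rw [← Finset.sum_sub_distrib]
    exact sum_le_sum fun b _ => by
      have := mul_le_mul_of_nonneg_left (hgain b) (hPs.1 (z, D) b)
      rw [mul_sub] at this; linarith
  have hstep1 := hgain (z, D)
  by_cases h0 : (0 : Fin (K + 1)) ∈ D
  · -- the hub is stale: the first step's gain suffices
    have hG1 : G (z, D) = (1 - t) * w 0 * θ - (1 - θ) * t := by rw [hG]; exact if_pos h0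
    have hQG : 0 ≤ ∑ b, Ph (z, D) b * G b := sum_nonneg fun b _ => mul_nonneg (hPs.1 _ _) (hG0 b)
    have hmin : δ ≤ ((1 - t) * w 0 * θ - (1 - θ) * t) / (K + θ) := min_le_right _ _
    have hKθ : (0 : ℝ) < K + θ := by positivity
    have hδK : δ * Ψ D ≤ (1 - t) * w 0 * θ - (1 - θ) * t := by
      calc δ * Ψ D ≤ δ * (θ + K) := mul_le_mul_of_nonneg_left hΨK hδ0
        _ ≤ ((1 - t) * w 0 * θ - (1 - θ) * t) / (K + θ) * (θ + K) := mul_le_mul_of_nonneg_right hmin (by positivity)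
        _ = (1 - t) * w 0 * θ - (1 - θ) * t := by field_simp; ring
    have e : Ψ (z, D).2 = Ψ D := rfl
    linarith [hstep2, hstep1, hQG, hδK, hG1]
  · -- the hub is fresh: use the second step's averaged gain
    have hhub := stalePotential_eq_hub_add_cold hΨ D
    rw [if_neg h0, mul_zero, zero_add] at hhub
    have hred := sectorAug_sum_gain_ge κ φ ht0 ht1 hw0 hM hM0 hμ hμ1 hα hdom hθ1 hreg (G := G) (fun _ => rfl) hPh z h0
    have hcnt := sum_entries_stale_ge κ hc D
    have hD : (1 - t) * w 0 * (1 - θ) * p * c * t / m * Ψ D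
        ≤ (1 - t) * w 0 * ((1 - θ) * (t / m) * p * ∑ r : Fin m, (if (κ r).succ ∈ D then (1 : ℝ) else 0)) := by
      have h := mul_le_mul_of_nonneg_left hcnt (show (0 : ℝ) ≤ (1 - t) * w 0 * (1 - θ) * p * (t / m) by
        have := sub_nonneg.mpr hθ1; have := sub_nonneg.mpr ht1; have := hw0 0; positivity)
      calc (1 - t) * w 0 * (1 - θ) * p * c * t / m * Ψ D
          = (1 - t) * w 0 * (1 - θ) * p * (t / m) * (c * ∑ j : Fin K, (if j.succ ∈ D then (1 : ℝ) else 0)) := by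
            rw [← hhub]; ring
        _ ≤ (1 - t) * w 0 * (1 - θ) * p * (t / m) * ∑ r : Fin m, (if (κ r).succ ∈ D then (1 : ℝ) else 0) := h
        _ = (1 - t) * w 0 * ((1 - θ) * (t / m) * p * ∑ r : Fin m, (if (κ r).succ ∈ D then (1 : ℝ) else 0)) := by ring
    have hmin : δ ≤ (1 - t) * w 0 * (1 - θ) * p * c * t / m := min_le_left _ _
    have hδΨ : δ * Ψ D ≤ (1 - t) * w 0 * (1 - θ) * p * c * t / m * Ψ D := mul_le_mul_of_nonneg_right hmin hΨ0
    have e : Ψ (z, D).2 = Ψ D := rfl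
    linarith [hstep2, hstep1, hG0 (z, D), hred, hD, hδΨ]

/-- **THE PRIMORDIAL CONTENT DISAPPEARS GEOMETRICALLY, UNIFORMLY IN THE LAWS GIVEN `p`:** from `δ_{(x, univ)}`,
**`Σ_{(z,D) : D ≠ ∅} λ̂_n(z,D) ≤ ((θ+K)/θ)·(1 − δ)^{⌊n/2⌋}`** (`δ` as above). [ours] -/
theorem sectorAug_stale_le_dom (hm : 1 ≤ m) (ht0 : 0 ≤ t) (ht1 : t ≤ 1) (hw0 : ∀ k, 0 ≤ w k) (hw1 : ∑ k, w k = 1)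
    (hM : ∀ k, IsRowStochastic (M k)) (hM0 : ∀ u v, M 0 u v = μ 0 v) (hμ : ∀ k x, 0 < μ k x) (hμ1 : ∀ k, ∑ u, μ k u = 1)
    {α : Fin m → (Fin (K + 1) → S) → ℝ}
    (hα : ∀ r z, α r z = min 1 (tensorFun μ (edgeFlowSwap (φ r) 0 (κ r).succ z) / tensorFun μ z))
    {p : ℝ} (hp0 : 0 ≤ p) (hdom : ∀ r u, p * μ (κ r).succ (φ r u) ≤ μ 0 u)
    {θ : ℝ} (hθ0 : 0 < θ) (hθ1 : θ ≤ 1) (hreg : (1 - θ) * t ≤ (1 - t) * w 0 * θ)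
    {c : ℕ} (hc : ∀ p' : Fin K, c ≤ (univ.filter (fun r : Fin m => κ r = p')).card)
    {Ph : (Fin (K + 1) → S) × Finset (Fin (K + 1)) → (Fin (K + 1) → S) × Finset (Fin (K + 1)) → ℝ}
    (hPh : ∀ a b, Ph a b = ∑ r : Fin m, t / m *
        ((fun r a => α r a.1) r a * (if b.1 = edgeFlowSwap (φ r) 0 (κ r).succ a.1
            ∧ b.2 = a.2.image (Equiv.swap (0 : Fin (K + 1)) (κ r).succ) then (1 : ℝ) else 0)
          + (α r a.1 - (fun r a => α r a.1) r a) * (if b.1 = edgeFlowSwap (φ r) 0 (κ r).succ a.1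
            ∧ b.2 = (fun (_ : Fin m) (D : Finset (Fin (K + 1))) => D) r a.2 then (1 : ℝ) else 0)
          + (1 - α r a.1) * (if b.1 = a.1 ∧ b.2 = (fun (_ : Fin m) (D : Finset (Fin (K + 1))) => D) r a.2 then (1 : ℝ) else 0))
      + (1 - t) * ∑ k : Fin (K + 1), w k * (coordKernel M k a.1 b.1
          * (if b.2 = (if k = 0 then a.2.erase 0 else a.2) then (1 : ℝ) else 0)))
    (x : Fin (K + 1) → S) (n : ℕ) :
    ∑ b ∈ univ.filter (fun b : (Fin (K + 1) → S) × Finset (Fin (K + 1)) => b.2 ≠ ∅),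
        lawAt Ph (Pi.single (x, (univ : Finset (Fin (K + 1)))) 1) n b
      ≤ (θ + K) / θ
        * (1 - min ((1 - t) * w 0 * (1 - θ) * p * c * t / m) (((1 - t) * w 0 * θ - (1 - θ) * t) / (K + θ))) ^ (n / 2) := by
  set δ := min ((1 - t) * w 0 * (1 - θ) * p * c * t / m) (((1 - t) * w 0 * θ - (1 - θ) * t) / (K + θ)) with hδ
  set Ψ : Finset (Fin (K + 1)) → ℝ := fun D => ∑ k : Fin (K + 1), (if k = 0 then θ else 1) * (if k ∈ D then (1 : ℝ) else 0) with hΨd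
  have hΨ : ∀ D, Ψ D = ∑ k : Fin (K + 1), (if k = 0 then θ else 1) * (if k ∈ D then (1 : ℝ) else 0) := fun D => rfl
  have hPs := sectorAug_isRowStochastic κ φ hm ht0 ht1 hw0 hw1 hM hμ hα hPh
  have hstep1 := sectorAug_step_stalePotential_le_one κ φ hm ht0 hw1 hM hμ hα hθ1 hreg hΨ hPh
  have hstep2 := sectorAug_twoStep_stalePotential_le κ φ hm ht0 ht1 hw0 hw1 hM hM0 hμ hμ1 hα hp0 hdom hθ0 hθ1 hreg hc hΨ hPh
  have hδ1 : 0 ≤ 1 - δ := by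
    have h2 : δ ≤ ((1 - t) * w 0 * θ - (1 - θ) * t) / (K + θ) := min_le_right _ _
    have h3 : ((1 - t) * w 0 * θ - (1 - θ) * t) / (K + θ) ≤ 1 := by
      rw [div_le_one (by positivity)]
      have hw01 : w 0 ≤ 1 := by
        calc w 0 ≤ ∑ k, w k := Finset.single_le_sum (fun k _ => hw0 k) (mem_univ 0)
          _ = 1 := hw1
      nlinarith [mul_nonneg (sub_nonneg.mpr ht1) (hw0 0), mul_nonneg (sub_nonneg.mpr hθ1) ht0, hθ0.le,
        mul_le_mul_of_nonneg_left hw01 (sub_nonneg.mpr ht1), Nat.cast_nonneg (α := ℝ) K]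
    linarith
  have hdecay : ∑ b, lawAt Ph (Pi.single (x, (univ : Finset (Fin (K + 1)))) 1) n b * Ψ b.2 ≤ (1 - δ) ^ (n / 2) * Ψ univ := by
    have h := lawMean_lawAt_le_of_twoStep_le hPs hδ1 (Φ := fun b => Ψ b.2) hstep1 hstep2
      (μ := Pi.single (x, (univ : Finset (Fin (K + 1)))) 1) (fun a => by rw [Pi.single_apply]; split_ifs <;> norm_num) n
    rw [lawMean_single] at h
    exact h
  have hL0 : ∀ b, 0 ≤ lawAt Ph (Pi.single (x, (univ : Finset (Fin (K + 1)))) 1) n b :=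
    fun b => lawAt_nonneg hPs (fun a => by rw [Pi.single_apply]; split_ifs <;> norm_num) n b
  obtain ⟨-, hΨK⟩ := stalePotential_le hθ0.le hΨ (univ : Finset (Fin (K + 1)))
  calc ∑ b ∈ univ.filter (fun b : (Fin (K + 1) → S) × Finset (Fin (K + 1)) => b.2 ≠ ∅),
          lawAt Ph (Pi.single (x, (univ : Finset (Fin (K + 1)))) 1) n b
      ≤ ∑ b ∈ univ.filter (fun b : (Fin (K + 1) → S) × Finset (Fin (K + 1)) => b.2 ≠ ∅),
          lawAt Ph (Pi.single (x, (univ : Finset (Fin (K + 1)))) 1) n b * (Ψ b.2 / θ) :=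
        sum_le_sum fun b hb => by
          have hne : b.2 ≠ ∅ := (Finset.mem_filter.mp hb).2
          have h1 : 1 ≤ Ψ b.2 / θ := by rw [le_div_iff₀ hθ0, one_mul]; exact stalePotential_ge_of_nonempty hθ0.le hθ1 hΨ hne
          simpa only [mul_one] using mul_le_mul_of_nonneg_left h1 (hL0 b)
    _ ≤ ∑ b, lawAt Ph (Pi.single (x, (univ : Finset (Fin (K + 1)))) 1) n b * (Ψ b.2 / θ) :=
        sum_le_sum_of_subset_of_nonneg (filter_subset _ _) fun b _ _ =>
          mul_nonneg (hL0 b) (div_nonneg (stalePotential_le hθ0.le hΨ b.2).1 hθ0.le)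
    _ = (∑ b, lawAt Ph (Pi.single (x, (univ : Finset (Fin (K + 1)))) 1) n b * Ψ b.2) / θ := by
        rw [Finset.sum_div]; exact sum_congr rfl fun b _ => by ring
    _ ≤ (1 - δ) ^ (n / 2) * Ψ univ / θ := div_le_div_of_nonneg_right hdecay hθ0.le
    _ ≤ (1 - δ) ^ (n / 2) * (θ + K) / θ :=
        div_le_div_of_nonneg_right (mul_le_mul_of_nonneg_left hΨK (pow_nonneg hδ1 _)) hθ0.le
    _ = (θ + K) / θ * (1 - δ) ^ (n / 2) := by ring

end TwoStepStale

end Summit.Ventures.LatticeQCDFlow.Scaling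

end
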